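import Summits.ResolutionOfSingularities.ResolutionOfSingularities.Theorems.UniversalCellsCampaignW82SmoothTwistGraded
import Summits.ResolutionOfSingularities.ResolutionOfSingularities.Theorems.UniversalCellsCampaignW82FamilyTransferGradedProofs
import Summits.ResolutionOfSingularities.ResolutionOfSingularities.Theorems.WeightedInvariantDescentPerfectToAllDescendResolutionData
import Summits.ResolutionOfSingularities.ResolutionOfSingularities.Theorems.WeightedInvariantDescentPerfectToAllDescendResolutionProps
import Summits.ResolutionOfSingularities.ResolutionOfSingularities.Theorems.DescentDescentPerfectToAllRobustModel
import Literature.AlgebraicGeometry.Limits.FiniteTypeModelDescent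
import Literature.AlgebraicGeometry.Resolution.FiniteSubextensionDescent
import Literature.AlgebraicGeometry.Resolution.SmoothOfRegularPerfectField
import Literature.AlgebraicGeometry.Resolution.SmoothStalksRegular
import Literature.AlgebraicGeometry.Resolution.AlterationsDescentStage
import Literature.AlgebraicGeometry.Resolution.QuasiExcellentSchemes
import Literature.AlgebraicGeometry.Motives.AbelianVarietyKernelDimension
import Mathlib.AlgebraicGeometry.Morphisms.Smooth
import Mathlib.AlgebraicGeometry.Morphisms.Proper
import Mathlib.FieldTheory.PurelyInseparable.Basic
import Mathlib.FieldTheory.IntermediateField.Adjoin.Basic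
import HarnessLib


/-!
# [OURS · L1 W8.2] The perfection step IS the smooth-twist step — at every constant field and every grade
# (rung B, prime-field / family transfer) — proofs

Cell `res-hironaka` (run/shared/lean/pub/res-hironaka/), LADDER-RESOLUTION rung L (RESCUE), slot W8.2 of
plan/RESCUE-SEED.md («PRIME-FIELD / UNIVERSALITY TRANSFER instead of descent»), host route `UniversalCells`,
host item `PrimeFieldToPerfect` (stmt-ResolutionOfSingularities-15233), second door `UniformComplexity`
`PrimeModelTransfer` (stmt-ResolutionOfSingularities-8933). Prover res-L1-s82-pv-1 (gen 2). THESES-FREE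
(imports only Theses-free campaign modules, four Theses-free `Theorems` files of the crux `DescentPerfectToAll`
lines, Literature and Mathlib).

WHAT IS PROVED (names from the statement file Theorems/UniversalCellsCampaignW82SmoothTwistGraded.lean,
p481193; everything unconditional unless it carries the hypothesis `hCP : CossartPiltant2019`, FACT-LIST F-02):

* `hasSmoothModelAtFiniteLevel_of_hasResolution` — DESCENT: for `f₀ : X₀ ⟶ Spec K` separated of finite type and
  a perfect purely inseparable `L ⊇ K` with `X₀ ×_K L` integral, a resolution of `X₀ ×_K L` comes from a proper
  birational model of `X₀ ×_K K'` SMOOTH over a finite purely inseparable `K' ⊆ L` (regular over perfect =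
  smooth; limit descent of the data `Theorems.stub_descendResolutionData` (p99203); fpqc descent of `Smooth`
  and of birationality along the radicial `X₀ ×_K L ⟶ X₀ ×_K K'`). This is «E1 ⇒ SmoothTwist» of
  Cruxes/PrimeFieldToPerfect/KERNEL.md §2/§5 («TRUE, Lean XL, NOT landed») — now landed.
* `hasResolution_pullback_of_hasSmoothModelAtFiniteLevel` — ASCENT: a smooth model at a finite purely
  inseparable level base-changes to a resolution over EVERY perfect extension of `K` (the mechanism of
  `Theorems.PrimeFieldToPerfect.stub_limitDescent`, p148751, isolated).
* `smoothTwistStepAt_of_perfectionStepAt`, `perfectionStepAt_of_smoothTwistStepAt`,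
  `perfectionStepAt_iff_smoothTwistStepAt` — for EVERY field `M` and every grade `n`:
  `PerfectionStepAt M n ↔ SmoothTwistStepAt M n` (descent/ascent above + EGA IV₃ 8.8.2 (ii) spreading to a
  finite level + dimension invariance under ground field extension `topologicalKrullDim_eq_of_isPullback`).
* the three lane-signed graded residuals of the slot in smooth-twist form:
  `perfectionStepDimLe_iff_smoothTwistStepDimLe` (door 1, p469608),
  `perfectionStepAlgClosedDimLe_iff_forall_smoothTwistStepAt` (door 2 v1, p470934),
  `perfectionStepAlgClosureFgDimLe_iff_forall_smoothTwistStepAt` (door 2 sharpest, p475047); by-name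
  directions `smoothTwistStepDimLe_of_perfectionStepDimLe` / `perfectionStepDimLe_of_smoothTwistStepDimLe` /
  `perfectionStepAlgClosureFgDimLe_of_forall_smoothTwistStepAt`.
* rungs (dimension `≤ 1` unconditional over ANY field, `≤ 3` given F-02) and the kernel grades from the
  smooth-twist step are in the sibling Theorems/UniversalCellsCampaignW82SmoothTwistRungs.lean.

CONSEQUENCE FOR THE SLOT (numbers, not adjectives): the residual of W8.2 on BOTH doors — `PerfectionStepDimLe p n`
resp. `PerfectionStepAlgClosureFgDimLe p n`, open exactly for `n ≥ 4` — is now kernel-checked EQUIVALENT to the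
finite-level selection/termination statement `SmoothTwistStep…` («r_F < ∞»: after finitely many `p`-th roots
of `t` some proper birational model is smooth), at every grade and every admissible constant field; the two
crux reductions by name (`primeFieldToPerfect_of_forall_perfectionStepDimLe_top`,
`primeModelTransfer_of_forall_perfectionStepAlgClosureFgDimLe_top`) therefore read equally with the
smooth-twist names (links in Theorems/UniversalCellsCampaignW82SmoothTwistLinks.lean).

HONEST FRAMING. OURS work of the rescue rung; replaces the role of §17 ¶2 p.89 l.59–62 / §2 p.4 l.22–24 of
[Hironaka2017] as explained in the statement file; NOT a statement of the manuscript, nothing attributed to its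
author, no typed candidate of the manuscript used even as a hypothesis. No external premise is used. AI work, weaker than expert review.

BARRIERS (`Literature/Barriers/ResolutionOfSingularities/`): nothing here crosses
`RegularNotGeometricallyRegular.lean` / `FrobeniusTwistResolution.lean` / `InseparableBaseChangeResolution.lean`:
the descent theorem STARTS from a resolution over the perfect field (where regular = smooth) and the ascent
theorem transports a SMOOTH model (legitimate); the equivalence says precisely that crossing the barriers at
grade `n` and terminating the Frobenius-root climb at grade `n` are the same problem.

## References
* A. Grothendieck, J. Dieudonné, EGA IV₃, Publ. Math. IHÉS 28 (1966), Thm. 8.8.2 (ii), Thm. 8.10.5. [EGAIV3]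
* U. Görtz, T. Wedhorn, *Algebraic Geometry I*, 2nd ed. (2020), Prop. 5.38, Thm. 10.63, Thm. 10.66. [GortzWedhorn2020]
* The Stacks Project, Tags 056S, 01S4, 02VL. [StacksProject]
* H. Matsumura, *Commutative Ring Theory* (1987), §30 Remark 2 after Thm. 30.3; Thm. 23.7. [Matsumura1987]
* Cruxes/PrimeFieldToPerfect/KERNEL.md §2 (E1), §5; STRATEGY-CENSUS.md; L/res-L1-s82-pv-1/NOTES.md — cell files.
-/

noncomputable section

set_option linter.dupNamespace false -- mandated namespace of this single-conjunct summit

open _root_.CategoryTheory _root_.CategoryTheory.Limits _root_.AlgebraicGeometry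
open Literature.AlgebraicGeometry.Resolution

namespace Summit.ResolutionOfSingularities.ResolutionOfSingularities.Theorems.CampaignW82

/-! ## Descent: a resolution over a perfect purely inseparable extension comes from a smooth model at a finite level -/

/-- **A resolution over the perfect closure descends to a smooth model at a finite purely inseparable
level** («E1 ⇒ SmoothTwist» of Cruxes/PrimeFieldToPerfect/KERNEL.md §2, recorded there as «TRUE, Lean XL, NOT
landed»; hypothesis-free in the resolution statements). Let `f₀ : X₀ ⟶ Spec K` be separated of finite type,
`L ⊇ K` perfect and purely inseparable with `X₀ ×_K L` integral, and `π : Y ⟶ X₀ ×_K L` a resolution. Then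
`Y` is regular of finite type over the perfect `L`, hence SMOOTH over `L` (`smooth_of_isRegular_of_perfectField`,
Matsumura §30 Rem. 2); the proper `π` is the base change of a proper `π_{K'} : Y_{K'} ⟶ X₀ ×_K K'` over a
subextension `K' ⊆ L` finite over `K`, along the transition map `t : X₀ ×_K L ⟶ X₀ ×_K K'`
(`Theorems.stub_descendResolutionData`, Görtz–Wedhorn I Thm. 10.63/10.66, EGA IV₃ 8.8.2/8.10.5); `t` is flat,
surjective, affine, universally closed and — `L/K'` being purely inseparable — universally injective, the
finite level `X₀ ×_K K'` is integral by flat descent, so birationality of `π` descends to `π_{K'}`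
(`Theorems.isBirational_of_isPullback_nilImmersion`); and smoothness of `Y ⟶ Spec L` descends to
`Y_{K'} ⟶ Spec K'` along the fpqc cover `Spec L ⟶ Spec K'` (Mathlib `LocalFlatDescent` through
`Resolution.descends_of_isPullback`). [cite: GortzWedhorn2020, Thm. 10.63 (p. 328)] -/
theorem hasSmoothModelAtFiniteLevel_of_hasResolution (K : Type) [Field K] {X₀ : Scheme.{0}}
    (f₀ : X₀ ⟶ Spec (.of K)) [IsSeparated f₀] [LocallyOfFiniteType f₀] [QuasiCompact f₀]
    (L : Type) [Field L] [PerfectField L] [Algebra K L] [IsPurelyInseparable K L]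
    [IsIntegral (pullback f₀ (Spec.map (CommRingCat.ofHom (algebraMap K L))))]
    (hres : Scheme.HasResolution (pullback f₀ (Spec.map (CommRingCat.ofHom (algebraMap K L))))) :
    HasSmoothModelAtFiniteLevel K f₀ := by
  haveI : Algebra.IsAlgebraic K L := IsPurelyInseparable.isAlgebraic K L
  let f : pullback f₀ (Spec.map (CommRingCat.ofHom (algebraMap K L))) ⟶ Spec (.of L) :=
    pullback.snd _ _
  -- ### the resolution is smooth over the perfect `L`
  obtain ⟨Y, π, hπ⟩ := hres
  haveI := hπ.isProper
  have hsm : Smooth (π ≫ f) := smooth_of_isRegular_of_perfectField (π ≫ f) hπ.isRegular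
  -- ### descent of the data to a finite level `K' ⊆ L`
  obtain ⟨K', hfin, YK, gK, e, t, hgK, ht₁, ht₂, sq⟩ :=
    Summit.ResolutionOfSingularities.ResolutionOfSingularities.Theorems.stub_descendResolutionData
      K L X₀ f₀ inferInstance inferInstance inferInstance Y π hπ.isProper
  haveI := hgK
  -- `t : X_L → X_{K'}` is the base change of `Spec L → Spec K'` along `X_{K'} → Spec K'`
  have ht : IsPullback t f (pullback.snd f₀ (Spec.map (CommRingCat.ofHom (algebraMap K K'))))
      (Spec.map (CommRingCat.ofHom (algebraMap K' L))) := by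
    refine IsPullback.of_right
      (h₁₂ := pullback.fst f₀ (Spec.map (CommRingCat.ofHom (algebraMap K K')))) (v₁₃ := f₀)
      (h₂₂ := Spec.map (CommRingCat.ofHom (algebraMap K K'))) ?_ ht₂ (IsPullback.of_hasPullback _ _)
    rw [ht₁, specTo_comp_specOf]
    exact IsPullback.of_hasPullback _ _
  obtain ⟨h₁, h₂, h₃⟩ := isAffineHom_flat_surjective_of_isPullback ht
  haveI := h₁
  haveI := h₂
  haveI := h₃
  haveI : UniversallyClosed t := universallyClosed_of_isPullback (k := K) ht
  haveI : UniversallyInjective t := MorphismProperty.of_isPullback ht.flip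
    (Summit.ResolutionOfSingularities.ResolutionOfSingularities.Theorems.universallyInjective_SpecMap_of_isPurelyInseparable
      K' L)
  -- the finite level `X_{K'}` is integral (flat descent from the integral `X_L`), in particular reduced
  haveI : IsIntegral (pullback f₀ (Spec.map (CommRingCat.ofHom (algebraMap K K')))) :=
    DeJong1996.Stage.isIntegral_of_flat_surjective t
  -- ### birationality descends along the radicial `t`
  have hbir : IsBirational gK := by
    have sq' : IsPullback (π ≫ 𝟙 _) e t gK := by
      simpa only [Category.comp_id] using sq.flip
    exact Summit.ResolutionOfSingularities.ResolutionOfSingularities.Theorems.isBirational_of_isPullback_nilImmersion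
      sq' hπ.isBirational
  -- ### smoothness over the ground field descends along `Spec L → Spec K'` (fpqc)
  have sqv : IsPullback e (π ≫ f)
      (gK ≫ pullback.snd f₀ (Spec.map (CommRingCat.ofHom (algebraMap K K'))))
      (Spec.map (CommRingCat.ofHom (algebraMap K' L))) :=
    isPullback_specTo_of_isPullback ht sq.flip
  have hbase : IsPullback (Spec.map (CommRingCat.ofHom (algebraMap K' L))) (𝟙 _) (𝟙 _)
      (Spec.map (CommRingCat.ofHom (algebraMap K' L))) :=
    IsPullback.of_vert_isIso ⟨by simp⟩
  have hsmK : Smooth (gK ≫ pullback.snd f₀ (Spec.map (CommRingCat.ofHom (algebraMap K K')))) :=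
    descends_of_isPullback (P := @Smooth) hbase sqv.flip hsm
  -- ### the smooth model at the finite level `K'`
  exact ⟨K', inferInstance, inferInstance, inferInstance, hfin, YK, gK, hgK, hbir, hsmK⟩

/-! ## Ascent: a smooth model at a finite level gives a resolution over every perfect extension -/

/-- **A smooth model at a finite purely inseparable level base-changes to a resolution over every PERFECT
extension** of the ground field (the mechanism of `Theorems.PrimeFieldToPerfect.stub_limitDescent`, p148751,
and of `Theorems.PrimeFieldToPerfect.Negative.hasResolution_level_of_smoothModel`, isolated): given
`f₀ : X₀ ⟶ Spec K` of finite type with `HasSmoothModelAtFiniteLevel K f₀` — a finite purely inseparable `K'/K`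
and a proper birational `ρ : Y ⟶ X₀ ×_K K'` with `Y` smooth over `K'` — and a perfect field `L ⊇ K`, the
extension `K'` embeds into `L` over `K` (Mathlib: `Nonempty (K' →ₐ[K] L)`, purely inseparable extensions map
uniquely into perfect fields), and the base change of `ρ` along the flat `Spec L ⟶ Spec K'` is proper and
birational (`Theorems.hasResolution_pullback_snd_of_flat`) with source smooth over the field `L`, hence regular
(Stacks 056S, `isRegularLocalRing_stalk_of_smooth_of_field`): a resolution of `(X₀ ×_K K') ×_{K'} L ≅ X₀ ×_K L`.
[cite: StacksProject, Tag 056S (Lemma 33.25.3)] -/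
theorem hasResolution_pullback_of_hasSmoothModelAtFiniteLevel (K : Type) [Field K] {X₀ : Scheme.{0}}
    (f₀ : X₀ ⟶ Spec (.of K)) [LocallyOfFiniteType f₀] [QuasiCompact f₀]
    (h : HasSmoothModelAtFiniteLevel K f₀) (L : Type) [Field L] [PerfectField L] [Algebra K L] :
    Scheme.HasResolution (pullback f₀ (Spec.map (CommRingCat.ofHom (algebraMap K L)))) := by
  obtain ⟨K', _, _, _, _, Y, ρ, hprop, hbir, hsm⟩ := h
  haveI := hprop
  haveI := hsm
  -- `K' ↪ L` over `K`
  obtain ⟨φ⟩ : Nonempty (K' →ₐ[K] L) := inferInstance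
  let j : K' →+* L := φ.toRingHom
  have hj : j.comp (algebraMap K K') = algebraMap K L := φ.comp_algebraMap
  have e' : Spec.map (CommRingCat.ofHom j) ≫ Spec.map (CommRingCat.ofHom (algebraMap K K')) =
      Spec.map (CommRingCat.ofHom (algebraMap K L)) := by
    rw [← Spec.map_comp, ← CommRingCat.ofHom_comp, hj]
  -- base change of the smooth model along the flat `Spec L → Spec K'`
  haveI : Flat (Spec.map (CommRingCat.ofHom j)) := DeJong1996.Stage.flat_specMap j
  haveI : IsNoetherian (pullback f₀ (Spec.map (CommRingCat.ofHom (algebraMap K K')))) :=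
    Scheme.isNoetherian_of_finiteType_over_field
      (pullback.snd f₀ (Spec.map (CommRingCat.ofHom (algebraMap K K'))))
  haveI : IsNoetherian Y :=
    Scheme.isNoetherian_of_finiteType_over_field
      (ρ ≫ pullback.snd f₀ (Spec.map (CommRingCat.ofHom (algebraMap K K'))))
  -- the source `Y ×_{K'} Spec L` is smooth over the field `L`, hence regular (Stacks 056S)
  have hreg : Scheme.IsRegular (pullback
      (ρ ≫ pullback.snd f₀ (Spec.map (CommRingCat.ofHom (algebraMap K K'))))
      (Spec.map (CommRingCat.ofHom j))) := fun y =>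
    isRegularLocalRing_stalk_of_smooth_of_field
      (pullback.snd (ρ ≫ pullback.snd f₀ (Spec.map (CommRingCat.ofHom (algebraMap K K'))))
        (Spec.map (CommRingCat.ofHom j))) y
  have hres :=
    Summit.ResolutionOfSingularities.ResolutionOfSingularities.Theorems.hasResolution_pullback_snd_of_flat
      f₀ (Spec.map (CommRingCat.ofHom (algebraMap K K'))) (Spec.map (CommRingCat.ofHom j)) ρ hbir hreg
  -- transport along `(X₀ ×_K K') ×_{K'} L ≅ X₀ ×_K L`
  exact hres.of_iso
    (pullbackLeftPullbackSndIso f₀ (Spec.map (CommRingCat.ofHom (algebraMap K K')))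
        (Spec.map (CommRingCat.ofHom j)) ≪≫ pullback.congrHom rfl e').hom

/-! ## The two steps are equivalent at every constant field `M` and every grade `n` -/

/-- **The perfection step implies the smooth-twist step** (every field `M`, every grade): given
`PerfectionStepAt M n`, resolution over `RatFunc M` in dimension `≤ n`, a finite purely inseparable level
`K ⊇ RatFunc M` and a separated `f₀ : X₀ ⟶ Spec K` of finite type and dimension `≤ n` with `X₀ ×_K L` integral
for a perfect purely inseparable `L ⊇ K`: `L` is perfect and purely inseparable over `RatFunc M` (tower),
`dim (X₀ ×_K L) = dim X₀ ≤ n` (`topologicalKrullDim_eq_of_isPullback`, Görtz–Wedhorn I Prop. 5.38), so the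
perfection step resolves `X₀ ×_K L`, and `hasSmoothModelAtFiniteLevel_of_hasResolution` descends that
resolution to a smooth model at a finite level. [folklore] -/
theorem smoothTwistStepAt_of_perfectionStepAt (M : Type) [Field M] {n : WithBot ℕ∞}
    (h : PerfectionStepAt M n) : SmoothTwistStepAt M n := by
  intro hM K _ _ _ _ X₀ f₀ hs hl hq hdim hint
  obtain ⟨L, _, _, _, _, hXL⟩ := hint
  haveI := hs
  haveI := hl
  haveI := hq
  haveI := hXL
  -- `L` is a perfect purely inseparable extension of `RatFunc M` (tower `RatFunc M ⊆ K ⊆ L`)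
  letI : Algebra (RatFunc M) L := ((algebraMap K L).comp (algebraMap (RatFunc M) K)).toAlgebra
  haveI : IsScalarTower (RatFunc M) K L := IsScalarTower.of_algebraMap_eq fun _ => rfl
  haveI : IsPurelyInseparable (RatFunc M) L := IsPurelyInseparable.trans (RatFunc M) K L
  -- dimension of `X_L = X₀ ×_K Spec L`
  have hdimL : topologicalKrullDim
      ↥(pullback f₀ (Spec.map (CommRingCat.ofHom (algebraMap K L)))) ≤ n := by
    rw [Literature.AlgebraicGeometry.Motives.topologicalKrullDim_eq_of_isPullback (algebraMap K L) f₀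
      (pullback.fst f₀ (Spec.map (CommRingCat.ofHom (algebraMap K L)))) (pullback.snd _ _)
      (IsPullback.of_hasPullback f₀ (Spec.map (CommRingCat.ofHom (algebraMap K L))))]
    exact hdim
  -- the perfection step resolves `X_L`; descend
  exact hasSmoothModelAtFiniteLevel_of_hasResolution K f₀ L
    (h hM L _ (pullback.snd _ _) inferInstance inferInstance inferInstance hXL hdimL)

/-- **The smooth-twist step implies the perfection step** (every field `M`, every grade; graded limit
descent, the mechanism of `Theorems.PrimeFieldToPerfect.stub_limitDescent`, p148751, in the slot's normal
form with dimension bookkeeping). Given `SmoothTwistStepAt M n`, resolution over `RatFunc M` in dimension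
`≤ n`, a perfect purely inseparable `L ⊇ RatFunc M` and an integral separated `f : X ⟶ Spec L` of finite type
and dimension `≤ n`: `X ≅ X₁ ×_{K₁} L` for the finite level `K₁ = (RatFunc M)(t) ⊆ L` generated by the finitely
many coefficients of a model (EGA IV₃ 8.8.2 (ii), `Limits.exists_isPullback_specMap_subalgebra`; `K₁` is finite
and purely inseparable over `RatFunc M`), `X₁` is integral (flat descent) of dimension `dim X₁ = dim X ≤ n`
(`topologicalKrullDim_eq_of_isPullback`) and integral over the perfect closure (witness `L`); the smooth-twist
step gives a smooth model at a finite level over `K₁`, and `hasResolution_pullback_of_hasSmoothModelAtFiniteLevel`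
base-changes it to a resolution of `X₁ ×_{K₁} L ≅ X`. [cite: EGAIV3, Thm. 8.8.2 (ii)] -/
theorem perfectionStepAt_of_smoothTwistStepAt (M : Type) [Field M] {n : WithBot ℕ∞}
    (h : SmoothTwistStepAt M n) : PerfectionStepAt M n := by
  intro hM L _ _ _ _ X f hs hl hq hX hd
  classical
  haveI := hs
  haveI := hl
  haveI := hq
  -- ### Step 1: descent of `X / L` to a finitely generated `RatFunc M`-subalgebra `R ⊆ L`
  obtain ⟨R, X', p', π, hRfg, hsep', hlft', hqc', hsq⟩ :=
    Literature.AlgebraicGeometry.Limits.exists_isPullback_specMap_subalgebra (K := RatFunc M) f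
  haveI := hsep'
  haveI := hlft'
  haveI := hqc'
  obtain ⟨t, ht⟩ := hRfg
  -- the finite level `K₁ = (RatFunc M)(t) ⊇ R`, an intermediate field of `L / RatFunc M`
  obtain ⟨K₁, hK₁⟩ : ∃ K₁ : IntermediateField (RatFunc M) L,
      K₁ = IntermediateField.adjoin (RatFunc M) (↑t : Set L) := ⟨_, rfl⟩
  have hRK₁ : ∀ x : L, x ∈ R → x ∈ K₁ := fun x hx => by
    rw [hK₁]
    rw [← ht] at hx
    exact IntermediateField.algebra_adjoin_le_adjoin (RatFunc M) _ hx
  haveI : Module.Finite (RatFunc M) K₁ := by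
    rw [hK₁]
    exact IntermediateField.finiteDimensional_adjoin fun x _ =>
      IsPurelyInseparable.isIntegral' (RatFunc M) x
  -- the inclusion `R ⊆ K₁` and the factorisation `Spec L → Spec K₁ → Spec R`
  let ι : R →+* K₁ := R.val.toRingHom.codRestrict K₁ fun x => hRK₁ x.1 x.2
  have hι : (algebraMap K₁ L).comp ι = R.val.toRingHom := RingHom.ext fun _ => rfl
  have hfac : Spec.map (CommRingCat.ofHom (algebraMap K₁ L)) ≫ Spec.map (CommRingCat.ofHom ι) =
      Spec.map (CommRingCat.ofHom R.val.toRingHom) := by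
    rw [← Spec.map_comp, ← CommRingCat.ofHom_comp, hι]
  -- ### Step 2: the model `X₁ = X' ×_R Spec K₁` over `K₁` and `X ≅ X₁ ×_{K₁} Spec L`
  let f₁ : pullback p' (Spec.map (CommRingCat.ofHom ι)) ⟶ Spec (.of K₁) := pullback.snd _ _
  have hw : π ≫ p' = (f ≫ Spec.map (CommRingCat.ofHom (algebraMap K₁ L))) ≫
      Spec.map (CommRingCat.ofHom ι) := by
    rw [Category.assoc, hfac]; exact hsq.w
  let c : X ⟶ pullback p' (Spec.map (CommRingCat.ofHom ι)) :=
    pullback.lift π (f ≫ Spec.map (CommRingCat.ofHom (algebraMap K₁ L))) hw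
  have hc₁ : c ≫ pullback.fst _ _ = π := pullback.lift_fst _ _ _
  have hc₂ : c ≫ f₁ = f ≫ Spec.map (CommRingCat.ofHom (algebraMap K₁ L)) := pullback.lift_snd _ _ _
  have hbig : IsPullback (c ≫ pullback.fst _ _) f p'
      (Spec.map (CommRingCat.ofHom (algebraMap K₁ L)) ≫ Spec.map (CommRingCat.ofHom ι)) := by
    rw [hc₁, hfac]; exact hsq
  have T : IsPullback c f f₁ (Spec.map (CommRingCat.ofHom (algebraMap K₁ L))) :=
    hbig.of_right hc₂ (IsPullback.of_hasPullback p' (Spec.map (CommRingCat.ofHom ι)))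
  -- `X → X₁` is flat and surjective, so `X₁` is integral; `X₁ ×_{K₁} Spec L ≅ X` is integral
  haveI : Flat c := MorphismProperty.of_isPullback (P := @Flat) T.flip
    (DeJong1996.Stage.flat_specMap (algebraMap K₁ L))
  haveI : Surjective c := MorphismProperty.of_isPullback (P := @Surjective) T.flip
    (DeJong1996.Stage.surjective_specMap (algebraMap K₁ L))
  haveI : IsIntegral (pullback p' (Spec.map (CommRingCat.ofHom ι))) :=
    DeJong1996.Stage.isIntegral_of_flat_surjective c
  have hint : IsIntegral
      (pullback f₁ (Spec.map (CommRingCat.ofHom (algebraMap K₁ L)))) := by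
    haveI : Nonempty ↥(pullback f₁ (Spec.map (CommRingCat.ofHom (algebraMap K₁ L)))) :=
      ⟨T.isoPullback.hom.base (Nonempty.some inferInstance)⟩
    exact isIntegral_of_isOpenImmersion T.isoPullback.inv
  -- dimension bookkeeping: `dim X₁ = dim X ≤ n`
  have hdim₁ : topologicalKrullDim ↥(pullback p' (Spec.map (CommRingCat.ofHom ι))) ≤ n := by
    rw [← Literature.AlgebraicGeometry.Motives.topologicalKrullDim_eq_of_isPullback (algebraMap K₁ L)
      f₁ c f T]
    exact hd
  -- ### Step 3: the smooth model at a finite level over `K₁`, base-changed to the perfect `L`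
  have hmodel : HasSmoothModelAtFiniteLevel K₁ f₁ := h hM K₁ _ f₁ inferInstance inferInstance
    inferInstance hdim₁ ⟨L, inferInstance, inferInstance, inferInstance, inferInstance, hint⟩
  exact (hasResolution_pullback_of_hasSmoothModelAtFiniteLevel K₁ f₁ hmodel L).of_iso T.isoPullback.inv

/-- **THE RESIDUAL OF SLOT W8.2 IS THE SMOOTH-TWIST STEP** — at every constant field `M` and every grade `n`,
unconditionally: `PerfectionStepAt M n ↔ SmoothTwistStepAt M n`. Resolution over the perfect field
`L ⊇ RatFunc M` (purely inseparable) in dimension `≤ n`, given resolution over `RatFunc M` in dimension `≤ n`,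
holds iff every irreducible, geometrically reduced variety of dimension `≤ n` over a finite purely inseparable
level over `RatFunc M` acquires, after a further FINITE purely inseparable extension, a proper birational model
SMOOTH over its ground field — the termination statement «`r_F < ∞`» of the Frobenius-root climb
(Cruxes/PrimeFieldToPerfect/STRATEGY-CENSUS.md). [folklore] -/
theorem perfectionStepAt_iff_smoothTwistStepAt (M : Type) [Field M] (n : WithBot ℕ∞) :
    PerfectionStepAt M n ↔ SmoothTwistStepAt M n :=
  ⟨smoothTwistStepAt_of_perfectionStepAt M, perfectionStepAt_of_smoothTwistStepAt M⟩

/-! ## The three lane-signed graded residuals of slot W8.2, in smooth-twist form -/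

/-- **Door 1** (`UniversalCells.PrimeFieldToPerfect`, p469608's residual): `PerfectionStepDimLe p n ↔
SmoothTwistStepDimLe p n` at every grade. [folklore] -/
theorem perfectionStepDimLe_iff_smoothTwistStepDimLe (p : ℕ) (n : WithBot ℕ∞) :
    PerfectionStepDimLe p n ↔ SmoothTwistStepDimLe p n :=
  ⟨fun h M _ _ _ => smoothTwistStepAt_of_perfectionStepAt M (h M),
    fun h M _ _ _ => perfectionStepAt_of_smoothTwistStepAt M (h M)⟩

/-- Door 1, forward direction by name. [folklore] -/
theorem smoothTwistStepDimLe_of_perfectionStepDimLe {p : ℕ} {n : WithBot ℕ∞}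
    (h : PerfectionStepDimLe p n) : SmoothTwistStepDimLe p n :=
  (perfectionStepDimLe_iff_smoothTwistStepDimLe p n).1 h

/-- Door 1, backward direction by name (this is the graded form of
`Theorems.PrimeFieldToPerfect.stub_limitDescent` in the slot's normal form). [folklore] -/
theorem perfectionStepDimLe_of_smoothTwistStepDimLe {p : ℕ} {n : WithBot ℕ∞}
    (h : SmoothTwistStepDimLe p n) : PerfectionStepDimLe p n :=
  (perfectionStepDimLe_iff_smoothTwistStepDimLe p n).2 h

/-- **Door 2, v1** (`UniformComplexity.PrimeModelTransfer`, p470934's residual at algebraically closed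
constant fields): `PerfectionStepAlgClosedDimLe p n ↔ ∀ M algebraically closed of characteristic p,
SmoothTwistStepAt M n`. [folklore] -/
theorem perfectionStepAlgClosedDimLe_iff_forall_smoothTwistStepAt (p : ℕ) (n : WithBot ℕ∞) :
    PerfectionStepAlgClosedDimLe p n ↔
      ∀ (M : Type) [Field M] [CharP M p] [IsAlgClosed M], SmoothTwistStepAt M n :=
  ⟨fun h M _ _ _ => smoothTwistStepAt_of_perfectionStepAt M (h M),
    fun h M _ _ _ => perfectionStepAt_of_smoothTwistStepAt M (h M)⟩

/-- **Door 2, sharpest form** (p475047's residual at the countably many constant fields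
`M = (𝔽_p(s))^{alg} ∩ K`, the one `PrimeModelTransfer` hangs on by
`primeModelTransfer_of_forall_perfectionStepAlgClosureFgDimLe_top`):
`PerfectionStepAlgClosureFgDimLe p n ↔ ∀ K s, SmoothTwistStepAt ((closure s)^{alg} ∩ K) n`. [folklore] -/
theorem perfectionStepAlgClosureFgDimLe_iff_forall_smoothTwistStepAt (p : ℕ) (n : WithBot ℕ∞) :
    PerfectionStepAlgClosureFgDimLe p n ↔
      ∀ (K : Type) [Field K] [CharP K p] [IsAlgClosed K] (s : Finset K),
        SmoothTwistStepAt (algebraicClosure (Subfield.closure (↑s : Set K)) K) n :=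
  ⟨fun h K _ _ _ s => smoothTwistStepAt_of_perfectionStepAt _ (h K s),
    fun h K _ _ _ s => perfectionStepAt_of_smoothTwistStepAt _ (h K s)⟩

end Summit.ResolutionOfSingularities.ResolutionOfSingularities.Theorems.CampaignW82

end
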